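import Summits.HodgeConjecture.HodgeConjecture.Theorems.K2E1SpectralSideDiscreteSum                    -- ★ p855062 (K2E1-p09): row 13 Hilbert-space half (brings B1, B2, p01 (ii), p02 compressions)
import Summits.HodgeConjecture.HodgeConjecture.Theorems.K2E1RightRegularHilbertSchmidtCompactQuotient   -- ★ p855057 (K2E1-p02): `R(f ⋆ g)` trace class on a compact quotient
import Literature.NumberTheory.Automorphic.AutomorphicQuotientSpectralExpansionPolar                     -- ★ `θ(g ⋆ h^*) = Σ_i ⟨e_i, R(g ⋆ h^*) e_i⟩` (generic + `cmDatum`)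
import Literature.NumberTheory.Automorphic.UnitaryGroupDiagTraceExpansion                                -- ★ `UnitaryGroup.diagTrace_eq_finsum_orbital` (the geometric side)
import Literature.NumberTheory.Automorphic.CompactQuotientFiniteMultiplicity                              -- ★ `multiplicity_lt_top_of_mem_discreteSpectrum_of_compactSpace`
import Literature.NumberTheory.Automorphic.AutomorphicSpectrumCompactQuotient                             -- ★ `discreteSpectrum_eq_top_of_compactSpace`
import HarnessLib

/-!
# K2·E1 — POOL-D: the ANISOTROPIC (compact-quotient) TRACE FORMULA ASSEMBLED in the row-13 currency —
# «`Σ_{[π]} m(π) Tr π(g ⋆ h^*) = Tr R(g ⋆ h^*) = θ(g ⋆ h^*) = Σ_{[γ]} a(γ) O_γ(g ⋆ h^*)`»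

Cell `hodgecm-mathlib`, Track B ∕ K2-LIT, squad K2, ENGINE E1 (line `K2_E1_TraceFormulaBeta`); crux H413 = `stmt-HodgeConjecture-24833` (route `HCCMUnconditional`);
seat K2E1-p09 (g0), DEAL K2E1-plan (g0) 2026-09-03T21:58:11Z «POOL-D».  PROOF FILE, lane `--supports stmt-HodgeConjecture-24833 --as helper`: THEOREMS ONLY — no
definition, no instance, no notation, no named fact, no `sorry`.  Closes no socket.  As K2E1-p06 (g2) recorded (K2/STATUS 21:55:28Z), the compact-quotient regime is ★
END TO END in `Literature/NumberTheory/Automorphic/` (the Gelbart §9–10 ∕ Rogawski §14.5 programme: ★ `AdelicGroupData.diagTrace`, ★ `AutomorphicQuotientSpectralExpansionPolar`,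
★ `UnitaryGroupDiagTraceExpansion`); this file is the BY-NAME DICTIONARY between that programme and the row-13 currency of the K2E1 line (★ p854885 `opTrace` ∕
`IsTraceClassOp`, the class sums `Σ_c #p⁻¹(c)·tr c` of ★ p854917 ∕ p855062) — nothing of it is re-proved.  HONEST LABEL: HC_CM is proved only modulo the 7 printed
citations (2 remaining named inputs: hLiu418 = `stmt-HodgeConjecture-24832`, h413 = `stmt-HodgeConjecture-24833`) until rung 0 closes; nothing here changes that count.

* §1 (any ★ `AdelicGroupData` with `L²_disc = L²` and finite multiplicities — the compact case by ★ `discreteSpectrum_eq_top_of_compactSpace`, ★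
  `multiplicity_lt_top_of_mem_discreteSpectrum_of_compactSpace`) **`hasSum_card_mul_classTrace_of_discreteSpectrum_eq_top`** — for ANY trace-class `R(F)` and any orthogonal
  irreducible decomposition `S` of `L²` itself: `HasSum (c ↦ #p⁻¹(c) · tr c) (opTrace (R F) B)` (★ p01 (ii) on `L²`, blocks read termwise ★ `inner_compression_apply`, regrouping ★ B2).
* §2 (compact automorphic quotient, the hypotheses of ★ `AutomorphicQuotientSpectralExpansionPolar`: `ρ ≠ 0` two-sided inversion-invariant on the closed `A_G·G(K)`, `ν` an
  inversion-invariant Haar measure) `opTrace_rightRegular_eq_diagTrace` — **`Tr R(g ⋆ h^*) = θ(g ⋆ h^*)`** along every Hilbert basis (★ `diagTrace_hasSum_inner_integratedOperator_self`);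
  **`hasSum_card_mul_classTrace_diagTrace`** — `Σ_c #p⁻¹(c) · tr c` sums to `θ(g ⋆ h^*)` (trace class of `R(g ⋆ h^*)`: ★ p855057).
* §3 (`U(H)`, `H` ANISOTROPIC over a CM field: ★ `UnitaryGroup.cmDatum`, `θ_{G′} = UnitaryGroup.diagTrace L N H μ ν hanis`) the same two, and **`cmDatum_hasSum_card_mul_classTrace_orbital`**
  — THE ANISOTROPIC TRACE FORMULA: with the ★ geometric expansion `θ_{G′}(F) = Σᶠ_{[γ]} C · d_{[γ]} · O_γ(F)` (★ `UnitaryGroup.diagTrace_eq_finsum_orbital`, [Rogawski1990, §14.5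
  p. 237]), `Σ_c #p⁻¹(c) · tr c (g ⋆ h^*)` sums to `Σᶠ_{[γ]} C · d_{[γ]} · O_γ(g ⋆ h^*)` — «`Σ_{π′} m(π′) tr π′(f′) = Σ_{𝒪} J(𝒪, f′)`».

References: [Rogawski1990] J. Rogawski, Ann. of Math. Stud. 123 (1990), §14.5 p. 237 («`T_{G′}(f′)` is the trace of `ρ(f′)` on `L(G′)` … `= Σ_{π′} m(π′) tr π′(f′)`»).
[Gelbart1975] S. Gelbart, Ann. of Math. Stud. 83 (1975), (9.11), Lemma 10.6, (10.12)–(10.14).  [GetzHahn2024] J. Getz, H. Hahn, GTM 300 (2024), §9.1 (9.5), Thm. 9.1.3.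
[Dixmier1977] J. Dixmier, *C\*-algebras* (1977), 5.4.6.
-/

set_option autoImplicit false
-- the mandated namespace has the single-problem summit's repeated segment (`HodgeConjecture.HodgeConjecture`)
set_option linter.dupNamespace false

noncomputable section

namespace Summit.HodgeConjecture.HodgeConjecture.Cruxes.H413.K2E1SpectralSideEqualsGeometricSideCompact

open MeasureTheory Measure NumberField CompactlySupported
open scoped InnerProductSpace ENNReal NNReal
open ContRepresentation
open Literature.NumberTheory.Automorphic Literature.MeasureTheory.Group
open Summit.HodgeConjecture.HodgeConjecture.Cruxes.H413.K2E1HilbertTraceClass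
open Summit.HodgeConjecture.HodgeConjecture.Cruxes.H413.K2E1DecompositionSumByClasses
open Summit.HodgeConjecture.HodgeConjecture.Cruxes.H413.K2E1OpTraceOrthogonalSum
open Summit.HodgeConjecture.HodgeConjecture.Cruxes.H413.K2E1RightRegularHilbertSchmidtCompactQuotient

universe u

/-! ## §1 `L²_disc = L²` with finite multiplicities: «`Tr R(F) = Σ_{[π]} m(π) Tr π(F)`» on `L²` itself -/

section DiscreteTop

variable {K : Type} [Field K] [NumberField K] {𝒢 : AdelicGroupData.{u} K} {μ : Measure 𝒢.automorphicQuotient} [𝒢.IsAutomorphicMeasure μ]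
  [MeasurableSpace 𝒢.Adelic] [BorelSpace 𝒢.Adelic] (ν : Measure 𝒢.Adelic) [IsFiniteMeasureOnCompacts ν] (F : C_c(𝒢.Adelic, ℂ))
  {S : Set (ClosedSubrep (𝒢.rightRegular μ))} {C : Type*}

/-- **«`Tr R(F) = Σ_{[π]} m(π) Tr π(F)`» when `L² = L²_disc` with finite multiplicities** (the compact-quotient regime).  Let `S` be an orthogonal irreducible decomposition of
`L²` itself (`iSupClosure S = ⊤`), `p : S → C` classifying, `tr : C → ℂ` with `opTrace R(F)|_W = tr (p W)` on members (every Hilbert basis), and `R(F)` TRACE CLASS.  Then `Σ_c #p⁻¹(c) · tr c`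
sums to `Tr R(F)` (any Hilbert basis `B` of `L²`), the coefficient at `[W₀]` being `m(W₀) = multiplicity W₀`.  Proof: `Tr R(F) = Σ_{W ∈ S} Tr (P_W R(F) ι_W)` (★ `hasSum_opTrace_compression`);
`⟨e, P_W R(F) ι_W e⟩ = ⟨e, R(F) e⟩ = ⟨e, R(F)|_W e⟩` along a basis of `W` (★ `inner_compression_apply`); regroup by classes (★ `hasSum_classes_mul_rightRegular`, with `L²_disc = L²`).
[cite: Rogawski1990, §14.5 p. 237] [cite: Gelbart1975, (10.12)–(10.14)] [cite: Dixmier1977, 5.4.6] -/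
theorem hasSum_card_mul_classTrace_of_discreteSpectrum_eq_top (htop : 𝒢.discreteSpectrum μ = ⊤) (h3 : multiplicity_lt_top_of_mem_discreteSpectrum 𝒢 μ)
    (hirr : ∀ W ∈ S, W.toContRep.IsTopIrreducible) (horth : S.Pairwise fun W W' => W.toSubmodule ⟂ W'.toSubmodule) (hspan : ClosedSubrep.iSupClosure S = ⊤)
    (hT : IsTraceClassOp ((𝒢.rightRegular μ).integratedOperator (𝒢.isUnitary_rightRegular μ) (𝒢.isStronglyContinuous_rightRegular_holds μ) ν F))
    (p : S → C) (hp : ∀ W W' : S, p W = p W' ↔ AreUnitarilyEquivalent (W : ClosedSubrep (𝒢.rightRegular μ)).toContRep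
      (W' : ClosedSubrep (𝒢.rightRegular μ)).toContRep)
    (tr : C → ℂ) (htr : ∀ (W : S) (ι : Type u) (b : HilbertBasis ι ℂ (W : ClosedSubrep (𝒢.rightRegular μ)).toSubmodule),
      opTrace ((W : ClosedSubrep (𝒢.rightRegular μ)).integratedOperatorRestrict (𝒢.isUnitary_rightRegular μ) (𝒢.isStronglyContinuous_rightRegular_holds μ) ν F) b =
        tr (p W))
    {ι₀ : Type*} (B : HilbertBasis ι₀ ℂ (𝒢.L2 μ)) :
    HasSum (fun c : C => (Nat.card {W : S // p W = c} : ℂ) * tr c)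
      (opTrace ((𝒢.rightRegular μ).integratedOperator (𝒢.isUnitary_rightRegular μ) (𝒢.isStronglyContinuous_rightRegular_holds μ) ν F) B) := by
  -- the decomposition of the Hilbert space `L²` by the members of `S`
  have hV : OrthogonalFamily ℂ (fun W : S => (W : ClosedSubrep (𝒢.rightRegular μ)).toSubmodule)
      fun W : S => ((W : ClosedSubrep (𝒢.rightRegular μ)).toSubmodule).subtypeₗᵢ := by
    rw [orthogonalFamily_iff_pairwise]
    exact ClosedSubrep.pairwise_subtype_isOrtho horth
  have hdense : (⨆ W : S, (W : ClosedSubrep (𝒢.rightRegular μ)).toSubmodule)ᗮ = ⊥ := ClosedSubrep.orthogonal_iSup_eq_bot_of_iSupClosure_eq_top hspan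
  have hex : ∀ W : S, ∃ (w : Set (W : ClosedSubrep (𝒢.rightRegular μ)).toSubmodule) (b : HilbertBasis w ℂ (W : ClosedSubrep (𝒢.rightRegular μ)).toSubmodule),
      ⇑b = ((↑) : w → _) := fun W => exists_hilbertBasis ℂ _
  choose w b _hb using hex
  -- (ii): `Tr R(F) = Σ_W Tr (P_W R(F) ι_W)` (★ K2E1-p01)
  have hsum := hasSum_opTrace_compression hV hdense b B hT
  -- each block: `Tr (P_W R(F) ι_W) = Tr R(F)|_W = tr (p W)` termwise
  have hsum' : HasSum (fun W : S => tr (p W))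
      (opTrace ((𝒢.rightRegular μ).integratedOperator (𝒢.isUnitary_rightRegular μ) (𝒢.isStronglyContinuous_rightRegular_holds μ) ν F) B) := by
    convert hsum using 2 with W
    rw [← htr W _ (b W)]
    unfold opTrace
    refine tsum_congr fun i => ?_
    rw [inner_compression_apply]
    simp only [Submodule.coe_inner, ClosedSubrep.coe_integratedOperatorRestrict_apply]
  have hspan' : ClosedSubrep.iSupClosure S = 𝒢.discreteSpectrum μ := hspan.trans htop.symm
  exact hasSum_classes_mul_rightRegular hirr horth hspan' p hp (fun W hW => h3 ⟨W, hirr W hW⟩) tr hsum'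

/-- The `tsum` form: `Tr R(F) = ∑' c, #p⁻¹(c) · tr c`. [cite: Rogawski1990, §14.5 p. 237] [cite: Gelbart1975, (10.14)] -/
theorem opTrace_rightRegular_eq_tsum_card_mul_classTrace (htop : 𝒢.discreteSpectrum μ = ⊤) (h3 : multiplicity_lt_top_of_mem_discreteSpectrum 𝒢 μ)
    (hirr : ∀ W ∈ S, W.toContRep.IsTopIrreducible) (horth : S.Pairwise fun W W' => W.toSubmodule ⟂ W'.toSubmodule) (hspan : ClosedSubrep.iSupClosure S = ⊤)
    (hT : IsTraceClassOp ((𝒢.rightRegular μ).integratedOperator (𝒢.isUnitary_rightRegular μ) (𝒢.isStronglyContinuous_rightRegular_holds μ) ν F))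
    (p : S → C) (hp : ∀ W W' : S, p W = p W' ↔ AreUnitarilyEquivalent (W : ClosedSubrep (𝒢.rightRegular μ)).toContRep
      (W' : ClosedSubrep (𝒢.rightRegular μ)).toContRep)
    (tr : C → ℂ) (htr : ∀ (W : S) (ι : Type u) (b : HilbertBasis ι ℂ (W : ClosedSubrep (𝒢.rightRegular μ)).toSubmodule),
      opTrace ((W : ClosedSubrep (𝒢.rightRegular μ)).integratedOperatorRestrict (𝒢.isUnitary_rightRegular μ) (𝒢.isStronglyContinuous_rightRegular_holds μ) ν F) b =
        tr (p W))
    {ι₀ : Type*} (B : HilbertBasis ι₀ ℂ (𝒢.L2 μ)) :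
    opTrace ((𝒢.rightRegular μ).integratedOperator (𝒢.isUnitary_rightRegular μ) (𝒢.isStronglyContinuous_rightRegular_holds μ) ν F) B =
      ∑' c : C, (Nat.card {W : S // p W = c} : ℂ) * tr c :=
  ((hasSum_card_mul_classTrace_of_discreteSpectrum_eq_top ν F htop h3 hirr horth hspan hT p hp tr htr B).tsum_eq).symm

end DiscreteTop

/-! ## §2 Compact automorphic quotient: «`Σ_{[π]} m(π) Tr π(g ⋆ h^*) = Tr R(g ⋆ h^*) = θ(g ⋆ h^*)`» -/

section Compact

variable {K : Type} [Field K] [NumberField K] (𝒢 : AdelicGroupData.{u} K) (μ : Measure 𝒢.automorphicQuotient) [𝒢.IsAutomorphicMeasure μ]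
  [LocallyCompactSpace 𝒢.Adelic] [SecondCountableTopology 𝒢.Adelic] [T2Space 𝒢.Adelic] [MeasurableSpace 𝒢.Adelic] [BorelSpace 𝒢.Adelic]
  [hH : IsClosed (𝒢.quotientSubgroup : Set 𝒢.Adelic)]
  (ρ : Measure 𝒢.quotientSubgroup) [ρ.IsMulLeftInvariant] [ρ.IsMulRightInvariant] [IsFiniteMeasureOnCompacts ρ] [SFinite ρ] [ρ.IsInvInvariant]
  (ν : Measure 𝒢.Adelic) [ν.IsHaarMeasure] [ν.IsInvInvariant]

/-- **`Tr R(g ⋆ h^*) = θ(g ⋆ h^*)` along every Hilbert basis of `L²(X, μ)`** for a compact automorphic quotient `X` — the leaf-currency reading (★ p854885 `opTrace`) of ★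
`AdelicGroupData.diagTrace_hasSum_inner_integratedOperator_self` (`θ = 𝒢.diagTrace μ ρ ν`, [Gelbart1975, (9.11)]; [Rogawski1990, §14.5]: «`θ_{G′}(f′) = Tr ρ(f′)`»).
[cite: Rogawski1990, §14.5 p. 237] [cite: Gelbart1975, (9.11) and Lemma 10.6] -/
theorem opTrace_rightRegular_eq_diagTrace [CompactSpace 𝒢.automorphicQuotient] (hρ : ρ ≠ 0) (g h F : C_c(𝒢.Adelic, ℂ))
    (hF : ∀ x, F x = mulConv ν (⇑g) (mulStar (⇑h)) x) {ι : Type*} (b : HilbertBasis ι ℂ (𝒢.L2 μ)) :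
    opTrace ((𝒢.rightRegular μ).integratedOperator (𝒢.isUnitary_rightRegular μ) (𝒢.isStronglyContinuous_rightRegular_holds μ) ν F) b = 𝒢.diagTrace μ ρ ν F :=
  (𝒢.diagTrace_hasSum_inner_integratedOperator_self μ ρ ν hρ g h F hF b).tsum_eq

/-- **«`Σ_{[π]} m(π) Tr π(g ⋆ h^*) = θ(g ⋆ h^*)`» on a compact automorphic quotient**: for `F = g ⋆ h^*`, an orthogonal irreducible decomposition `S` of `L²`, a classifying map `p` and
a class function `tr` agreeing with `Tr R(F)|_W` on members, `Σ_c #p⁻¹(c) · tr c` sums to `θ(F)` (`R(F) = R(g) R(h)^†` is trace class: ★ p855057; `L²_disc = L²`: ★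
`discreteSpectrum_eq_top_of_compactSpace`; finite multiplicities: ★ `multiplicity_lt_top_of_mem_discreteSpectrum_of_compactSpace`). [cite: Rogawski1990, §14.5 p. 237]
[cite: Gelbart1975, (10.14)] -/
theorem hasSum_card_mul_classTrace_diagTrace [CompactSpace 𝒢.automorphicQuotient] (hρ : ρ ≠ 0) (g h F : C_c(𝒢.Adelic, ℂ))
    (hF : ∀ x, F x = mulConv ν (⇑g) (mulStar (⇑h)) x)
    {S : Set (ClosedSubrep (𝒢.rightRegular μ))} (hirr : ∀ W ∈ S, W.toContRep.IsTopIrreducible)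
    (horth : S.Pairwise fun W W' => W.toSubmodule ⟂ W'.toSubmodule) (hspan : ClosedSubrep.iSupClosure S = ⊤)
    {C : Type*} (p : S → C) (hp : ∀ W W' : S, p W = p W' ↔ AreUnitarilyEquivalent (W : ClosedSubrep (𝒢.rightRegular μ)).toContRep
      (W' : ClosedSubrep (𝒢.rightRegular μ)).toContRep)
    (tr : C → ℂ) (htr : ∀ (W : S) (ι : Type u) (b : HilbertBasis ι ℂ (W : ClosedSubrep (𝒢.rightRegular μ)).toSubmodule),
      opTrace ((W : ClosedSubrep (𝒢.rightRegular μ)).integratedOperatorRestrict (𝒢.isUnitary_rightRegular μ) (𝒢.isStronglyContinuous_rightRegular_holds μ) ν F) b =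
        tr (p W)) :
    HasSum (fun c : C => (Nat.card {W : S // p W = c} : ℂ) * tr c) (𝒢.diagTrace μ ρ ν F) := by
  -- `h^* ∈ C_c` and `F = g ⋆ h^*` as a `mulConv` of two members of `C_c`, so that `R(F)` is trace class (★ p855057)
  obtain ⟨hs, hhs⟩ := exists_compactlySupported_mulStar h
  have hF' : ∀ x, F x = mulConv ν (⇑g) (⇑hs) x := fun x => by
    rw [hF x, show (⇑hs : 𝒢.Adelic → ℂ) = mulStar (⇑h) from funext hhs]
  have hT := isTraceClassOp_integratedOperator_rightRegular_mulConv 𝒢 μ ρ ν hρ g hs F hF'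
  obtain ⟨w, B, -⟩ := exists_hilbertBasis ℂ (𝒢.L2 μ)
  rw [← opTrace_rightRegular_eq_diagTrace 𝒢 μ ρ ν hρ g h F hF B]
  exact hasSum_card_mul_classTrace_of_discreteSpectrum_eq_top ν F (𝒢.discreteSpectrum_eq_top_of_compactSpace μ)
    (𝒢.multiplicity_lt_top_of_mem_discreteSpectrum_of_compactSpace μ) hirr horth hspan hT p hp tr htr B

end Compact

/-! ## §3 The anisotropic unitary groups `U(H)`: the TRACE FORMULA «`Σ_{[π]} m(π) Tr π(g ⋆ h^*) = Σᶠ_{[γ]} C · d_{[γ]} · O_γ(g ⋆ h^*)`» -/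

section Anisotropic

open Literature.AlgebraicGeometry.ShimuraVarieties (hermForm)

variable (L : Type) [Field L] [NumberField L] [IsCMField L] (N : ℕ) (H : Matrix (Fin N) (Fin N) L)
  [MeasurableSpace (UnitaryGroup.cmDatum L N H).Adelic] [BorelSpace (UnitaryGroup.cmDatum L N H).Adelic]
  (μ : Measure (UnitaryGroup.cmDatum L N H).automorphicQuotient) [(UnitaryGroup.cmDatum L N H).IsAutomorphicMeasure μ]
  (ν : Measure (UnitaryGroup.cmDatum L N H).Adelic) [ν.IsHaarMeasure] [ν.IsInvInvariant]

/-- **`Tr R(g ⋆ h^*) = θ_{G′}(g ⋆ h^*)` for `G′ = U(H)`, `H` anisotropic** (★ `UnitaryGroup.diagTrace_hasSum_inner_integratedOperator_self` read through ★ p854885 `opTrace`).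
[cite: Rogawski1990, §14.5 p. 237] [cite: Gelbart1975, (9.11)] -/
theorem cmDatum_opTrace_rightRegular_eq_diagTrace (hanis : ∀ x : Fin N → L, hermForm (cmConjRingHom L) H x x = 0 → x = 0)
    (g h F : C_c((UnitaryGroup.cmDatum L N H).Adelic, ℂ)) (hF : ∀ x, F x = mulConv ν (⇑g) (mulStar (⇑h)) x)
    {ι : Type*} (b : HilbertBasis ι ℂ ((UnitaryGroup.cmDatum L N H).L2 μ)) :
    opTrace (((UnitaryGroup.cmDatum L N H).rightRegular μ).integratedOperator ((UnitaryGroup.cmDatum L N H).isUnitary_rightRegular μ)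
        ((UnitaryGroup.cmDatum L N H).isStronglyContinuous_rightRegular_holds μ) ν F) b =
      UnitaryGroup.diagTrace L N H μ ν hanis F :=
  (UnitaryGroup.diagTrace_hasSum_inner_integratedOperator_self L N H μ ν hanis g h F hF b).tsum_eq

/-- **«`Σ_{[π]} m(π) Tr π(g ⋆ h^*) = θ_{G′}(g ⋆ h^*)`» for `G′ = U(H)`, `H` anisotropic**: for `F = g ⋆ h^*`, an orthogonal irreducible decomposition `S` of
`L²(U(H)(L⁺)\U(H)(𝔸_{L⁺}), μ)`, a classifying map `p` and a class function `tr` agreeing with `Tr R(F)|_W` on members, `Σ_c #p⁻¹(c) · tr c` sums to `θ_{G′}(F)` (compactness: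
★ `compactSpace_cmDatum_automorphicQuotient`; trace class: ★ p855057 `cmDatum_isTraceClassOp_integratedOperator_mulConv`). [cite: Rogawski1990, §14.5 p. 237] [cite: Gelbart1975, (10.14)] -/
theorem cmDatum_hasSum_card_mul_classTrace_diagTrace (hanis : ∀ x : Fin N → L, hermForm (cmConjRingHom L) H x x = 0 → x = 0)
    (g h F : C_c((UnitaryGroup.cmDatum L N H).Adelic, ℂ)) (hF : ∀ x, F x = mulConv ν (⇑g) (mulStar (⇑h)) x)
    {S : Set (ClosedSubrep ((UnitaryGroup.cmDatum L N H).rightRegular μ))} (hirr : ∀ W ∈ S, W.toContRep.IsTopIrreducible)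
    (horth : S.Pairwise fun W W' => W.toSubmodule ⟂ W'.toSubmodule) (hspan : ClosedSubrep.iSupClosure S = ⊤)
    {C : Type*} (p : S → C) (hp : ∀ W W' : S, p W = p W' ↔ AreUnitarilyEquivalent (W : ClosedSubrep ((UnitaryGroup.cmDatum L N H).rightRegular μ)).toContRep
      (W' : ClosedSubrep ((UnitaryGroup.cmDatum L N H).rightRegular μ)).toContRep)
    (tr : C → ℂ) (htr : ∀ (W : S) (ι : Type) (b : HilbertBasis ι ℂ (W : ClosedSubrep ((UnitaryGroup.cmDatum L N H).rightRegular μ)).toSubmodule),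
      opTrace ((W : ClosedSubrep ((UnitaryGroup.cmDatum L N H).rightRegular μ)).integratedOperatorRestrict ((UnitaryGroup.cmDatum L N H).isUnitary_rightRegular μ)
        ((UnitaryGroup.cmDatum L N H).isStronglyContinuous_rightRegular_holds μ) ν F) b = tr (p W)) :
    HasSum (fun c : C => (Nat.card {W : S // p W = c} : ℂ) * tr c) (UnitaryGroup.diagTrace L N H μ ν hanis F) := by
  haveI := UnitaryGroup.compactSpace_cmDatum_automorphicQuotient L N H hanis
  obtain ⟨hs, hhs⟩ := exists_compactlySupported_mulStar h
  have hF' : ∀ x, F x = mulConv ν (⇑g) (⇑hs) x := fun x => by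
    rw [hF x, show (⇑hs : (UnitaryGroup.cmDatum L N H).Adelic → ℂ) = mulStar (⇑h) from funext hhs]
  have hT := cmDatum_isTraceClassOp_integratedOperator_mulConv L N H μ ν hanis g hs F hF'
  obtain ⟨w, B, -⟩ := exists_hilbertBasis ℂ ((UnitaryGroup.cmDatum L N H).L2 μ)
  rw [← cmDatum_opTrace_rightRegular_eq_diagTrace L N H μ ν hanis g h F hF B]
  exact hasSum_card_mul_classTrace_of_discreteSpectrum_eq_top ν F ((UnitaryGroup.cmDatum L N H).discreteSpectrum_eq_top_of_compactSpace μ)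
    ((UnitaryGroup.cmDatum L N H).multiplicity_lt_top_of_mem_discreteSpectrum_of_compactSpace μ) hirr horth hspan hT p hp tr htr B

variable [∀ γ : (UnitaryGroup.cmDatum L N H).Adelic, MeasurableSpace ((UnitaryGroup.cmDatum L N H).Adelic ⧸
    Subgroup.centralizer ({γ} : Set (UnitaryGroup.cmDatum L N H).Adelic))]
  [∀ γ : (UnitaryGroup.cmDatum L N H).Adelic, BorelSpace ((UnitaryGroup.cmDatum L N H).Adelic ⧸
    Subgroup.centralizer ({γ} : Set (UnitaryGroup.cmDatum L N H).Adelic))]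

/-- **THE ANISOTROPIC TRACE FORMULA, assembled: «`Σ_{[π]} m(π) Tr π(g ⋆ h^*) = Σᶠ_{[γ]} C · d_{[γ]} · O_γ(g ⋆ h^*)`»** for `G′ = U(H)`, `H` anisotropic over the CM field `L`.
With the data `C > 0`, `d_{[γ]} ∈ (0, ∞)`, invariant measures `μ_{[γ]}` on `U(H)(𝔸) ⧸ U(H)(𝔸)_γ` of the ★ geometric expansion (★ `UnitaryGroup.diagTrace_eq_finsum_orbital`:
`θ_{G′}(F) = Σᶠ_{[γ]} C · d_{[γ]} · ∫ F(y γ y⁻¹) dμ_{[γ]}`, finitely many classes), for every `F = g ⋆ h^*`, every orthogonal irreducible decomposition `S` of `L²`, every classifying `p`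
and class function `tr` agreeing with `Tr R(F)|_W` on members: the SPECTRAL class sum `Σ_c #p⁻¹(c) · tr c` (coefficient `= multiplicity`, ★ `card_fibre_eq_multiplicity_rightRegular`)
CONVERGES TO the GEOMETRIC side.  [Rogawski1990, §14.5 p. 237: «`J_{G′}(f′) = T_{G′}(f′)` … `T_{G′}(f′) = Σ_{π′} m(π′) tr π′(f′)`»]; [Gelbart1975, (9.11), (10.14)].
[cite: Rogawski1990, §14.5 p. 237] [cite: Gelbart1975, (9.11) and (10.14)] -/
theorem cmDatum_hasSum_card_mul_classTrace_orbital (hanis : ∀ x : Fin N → L, hermForm (cmConjRingHom L) H x x = 0 → x = 0) :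
    ∃ (Cst : ℝ≥0) (dc : ConjClasses (UnitaryGroup.cmDatum L N H).arithmeticSubgroup → ℝ≥0∞)
      (μC : ∀ c : ConjClasses (UnitaryGroup.cmDatum L N H).arithmeticSubgroup, Measure ((UnitaryGroup.cmDatum L N H).Adelic ⧸
        Subgroup.centralizer ({((Quotient.out c : (UnitaryGroup.cmDatum L N H).arithmeticSubgroup) :
          (UnitaryGroup.cmDatum L N H).Adelic)} : Set (UnitaryGroup.cmDatum L N H).Adelic))),
      0 < Cst ∧ (∀ c, dc c ≠ 0 ∧ dc c ≠ ∞) ∧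
      (∀ c, SMulInvariantMeasure (UnitaryGroup.cmDatum L N H).Adelic _ (μC c) ∧ IsFiniteMeasureOnCompacts (μC c) ∧ μC c ≠ 0) ∧
      ∀ (g h F : C_c((UnitaryGroup.cmDatum L N H).Adelic, ℂ)), (∀ x, F x = mulConv ν (⇑g) (mulStar (⇑h)) x) →
      ∀ {S : Set (ClosedSubrep ((UnitaryGroup.cmDatum L N H).rightRegular μ))}, (∀ W ∈ S, W.toContRep.IsTopIrreducible) →
        (S.Pairwise fun W W' => W.toSubmodule ⟂ W'.toSubmodule) → ClosedSubrep.iSupClosure S = ⊤ →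
      ∀ {C : Type*} (p : S → C), (∀ W W' : S, p W = p W' ↔ AreUnitarilyEquivalent (W : ClosedSubrep ((UnitaryGroup.cmDatum L N H).rightRegular μ)).toContRep
          (W' : ClosedSubrep ((UnitaryGroup.cmDatum L N H).rightRegular μ)).toContRep) →
      ∀ (tr : C → ℂ), (∀ (W : S) (ι : Type) (b : HilbertBasis ι ℂ (W : ClosedSubrep ((UnitaryGroup.cmDatum L N H).rightRegular μ)).toSubmodule),
          opTrace ((W : ClosedSubrep ((UnitaryGroup.cmDatum L N H).rightRegular μ)).integratedOperatorRestrict ((UnitaryGroup.cmDatum L N H).isUnitary_rightRegular μ)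
            ((UnitaryGroup.cmDatum L N H).isStronglyContinuous_rightRegular_holds μ) ν F) b = tr (p W)) →
      HasSum (fun c : C => (Nat.card {W : S // p W = c} : ℂ) * tr c)
        (∑ᶠ c : ConjClasses (UnitaryGroup.cmDatum L N H).arithmeticSubgroup,
          ((Cst : ℝ) : ℂ) * ((dc c).toReal : ℂ) * ∫ y, descConj
            ((Quotient.out c : (UnitaryGroup.cmDatum L N H).arithmeticSubgroup) : (UnitaryGroup.cmDatum L N H).Adelic)
            (Subgroup.centralizer ({((Quotient.out c : (UnitaryGroup.cmDatum L N H).arithmeticSubgroup) :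
              (UnitaryGroup.cmDatum L N H).Adelic)} : Set (UnitaryGroup.cmDatum L N H).Adelic))
            (fun _ hg => Subgroup.mem_centralizer_singleton_iff.1 hg) F y ∂(μC c)) := by
  obtain ⟨Cst, dc, μC, hC, hdc, hμC, hgeo⟩ := UnitaryGroup.diagTrace_eq_finsum_orbital L N H μ ν hanis
  refine ⟨Cst, dc, μC, hC, hdc, hμC, fun g h F hF S hirr horth hspan C p hp tr htr => ?_⟩
  rw [← (hgeo F).2]
  exact cmDatum_hasSum_card_mul_classTrace_diagTrace L N H μ ν hanis g h F hF hirr horth hspan p hp tr htr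

end Anisotropic

end Summit.HodgeConjecture.HodgeConjecture.Cruxes.H413.K2E1SpectralSideEqualsGeometricSideCompact

end
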